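import Literature.MathematicalPhysics.QuantumLattice.HubbardTTPrimeThermalStatesEntropyDensityCanonical
import Literature.MathematicalPhysics.QuantumLattice.HubbardTTPrimeThermalPhaseCoexistence
import Literature.MathematicalPhysics.QuantumLattice.HubbardTTPrimePhaseCoexistenceExclusion
import Literature.MathematicalPhysics.QuantumLattice.HubbardTTPrimeThermalPressureDensity
import HarnessLib

/-!
# Thermal phase separation in the CANONICAL ensemble: a canonical thermal state of the 2D `t–t'` Hubbard model that
# is a macroscopic mixture of phases of densities `n₁ < n₂` forces the pressure `p(β; ·)` to be AFFINE on `[n₁, n₂]`;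
# certified «pressure floor above the chord of caps» EXCLUDES it

Topic `Literature/MathematicalPhysics/QuantumLattice` (family `hubbard`); the `T > 0` twin of
`HubbardTTPrimePhaseCoexistenceExclusion` (`T = 0`: a translation-invariant ground state of mean density `n` that is a
mixture of phases of densities `n₁ < n₂` forces `e(·)` affine on `[n₁,n₂]`) for the thermal object of record of the
`T > 0` certificate family (cell `hubbard-thermal`): torus limits `ω` of the canonical `(rectN n L, S^z = 0)`-sector Gibbs
states at `β > 0`, `ω.IsTorusLimitOfMixture (sectorGibbsCount n) (sectorGibbsWeightTT' β t t' U n ·) (sectorGibbsVectorTT' t t' U n ·) Ls`,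
and the canonical pressure `p(n) = pressureTT' β t t' U n` (concave in `n`, `HubbardTTPrimeThermalPressureDensity`).
The grand-canonical twin (first-order transitions in `μ`, density jumps) is `HubbardTTPrimeThermalPhaseCoexistence`.

PROVED (`U ≥ 0`, `β > 0`):

* §1 (real analysis) `concaveOn_affine_of_eq_convexComb`: a concave function touching a chord at an interior point is the
  chord on the segment (from the convex version of `HubbardTTPrimePhaseCoexistenceExclusion`).
* §2 **the canonical variational upper bound for EVERY translation-invariant state at its own density**
  (`IsTranslationInvariant.vonNeumannEntropy_rdm_halfOpenBox_le_pressureTT'`, `0 < ρ(ω) < 2`):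
  `S(ω_{[0,ℓ)²}) ≤ ℓ²·(p(ρ(ω)) + β e_Φ(ω)) + β(8|t|+16|t'|)ℓ + 2 log(ℓ²+1)` — no translation-invariant state has entropy
  density above `p(ρ(ω)) + βe_Φ(ω)` (the grand-canonical bound at the supporting chemical potential of `p` at `ρ(ω)`).
* §3 MIXTURES THAT ARE CANONICAL THERMAL STATES. Let `ω₁, ω₂` be translation invariant with densities `ρ₁, ρ₂ ∈ (0,2)`,
  `0 < λ ≤ 1`, and let `ω = λω₁ + (1−λ)ω₂` be a canonical thermal torus-limit state at `(β; t,t',U; n)`, `0 < n < 2`. Then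
  `n = λρ₁ + (1−λ)ρ₂` (`density_eq_convexComb_of_mix_sectorGibbs`); for every box
  `ℓ²·p(n) ≤ ℓ²·(λp(ρ₁) + (1−λ)p(ρ₂)) + β(8|t|+16|t'|)ℓ + 2log(ℓ²+1) + log 2` (`sq_mul_pressureTT'_le_of_mix_sectorGibbs`:
  entropy of the mixture from below = `ℓ²(p(n) + βe)`, mixing-entropy bound, §2 for the components, affinity of `e_Φ`);
  hence **`pressureTT'_le_convexComb_of_mix_sectorGibbs`: `p(n) ≤ λ p(ρ₁) + (1−λ) p(ρ₂)`**, and with concavity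
  **`pressureTT'_eq_convexComb_of_mix_sectorGibbs`: `p(λρ₁ + (1−λ)ρ₂) = λ p(ρ₁) + (1−λ) p(ρ₂)`** and (`0 < λ < 1`)
  **`pressureTT'_eq_chord_on_segment_of_mix_sectorGibbs`: `p` IS AFFINE ON `[ρ₁, ρ₂]`** — thermal phase separation at
  density `n` into phases of densities `ρ₁ < n < ρ₂` forces a flat piece of the (concave) pressure–density curve.
* §4 **each PHASE is a variational equilibrium state at its own density**: `S(ω₁,[0,ℓ)²})/ℓ² → p(ρ₁) + β e_Φ(ω₁)`
  (`tendsto_vonNeumannEntropy_rdm_div_sq_of_mix_sectorGibbs_left`, with the finite-box two-sided window).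
* §5 **CERTIFIED EXCLUSION** (`not_isTorusLimitOfMixture_mix_of_chord_lt_floor`): a pressure FLOOR `W ≤ p(n)` at
  `n = λρ₁ + (1−λ)ρ₂` and pressure CAPS `p(ρ₁) ≤ Q₁`, `p(ρ₂) ≤ Q₂` with `λQ₁ + (1−λ)Q₂ < W` certify that NO canonical thermal
  state at `(β; n)` is the mixture `λω₁ + (1−λ)ω₂` of translation-invariant states of densities `ρ₁, ρ₂` — «no thermal phase
  separation into the densities `ρ₁, ρ₂` at `(β; t,t',U; n)`», a competing-order word for the phase map at `T > 0` from the
  existing pressure certificates (floors: cluster / seam-dressed / open-box; caps: hot anchors and chords); strict concavity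
  at one interior point suffices (`…_of_lt_at`).

Everything is PROVED; no definition, no named fact, no number. HONEST SCOPE: an exclusion of MACROSCOPIC coexistence
(mixtures of translation-invariant states), i.e. of a flat piece of `p(β;·)`; it says nothing about finite-wavelength
inhomogeneity (stripes are translation invariant in this sense only after cell averaging) nor about presence of any order.

## Mathlib / tree search

REUSED: `convexOn_affine_of_eq_convexComb` (`HubbardTTPrimePhaseCoexistenceExclusion`); `rdm_mix`,
`vonNeumannEntropy_rdm_mix_le` (`HubbardTTPrimeThermalPhaseCoexistence`); `meanEnergy_mix`, `density_mix`
(`InfVolFermionState`, `InfVolFermionStateMixture`); `IsTorusLimitOfMixture.sq_mul_le_vonNeumannEntropy_rdm_halfOpenBox_of_sectorGibbs`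
(`…ThermalStatesEntropyDensityCanonical`); `IsTranslationInvariant.vonNeumannEntropy_rdm_halfOpenBox_le` (`…ThermalStatesEntropyDensity`);
`exists_chemicalPotential_pressureTT'_eq` (`…GrandCanonicalEnsembleEquivalence`); `gcPressureTT'Zeeman_zero`;
`concaveOn_pressureTT'_density` (`…ThermalPressureDensity`); `IsTorusLimitOfMixture.density_eq_of_sectorGibbs`
(`TorusSectorGibbsMixture`); Mathlib `ConcaveOn.neg`, `le_of_forall_pos_le_add`, `exists_nat_gt`.
`lean search 'mix.*sectorGibbs|PhaseCoexistence.*Canonical|phase.?separation'` (2026-08-27): only the `T = 0` file and the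
grand-canonical `T > 0` file above.

## References

* R. B. Israel, *Convexity in the Theory of Lattice Gases* (1979), Thm. I.2.4, Lemma II.3.1 (tangent functionals, flat pieces
  of the pressure and coexistence). [cite: Israel1979, Thm. I.2.4]
* V. J. Emery, S. A. Kivelson, H. Q. Lin, Phys. Rev. Lett. 64 (1990) 475, pp. 475–476 (phase separation in the `t–J` /
  Hubbard models; Maxwell construction on the energy–density curve). [cite: EmeryKivelsonLin1990, pp. 475–476]
* H. Araki, H. Moriya, Rev. Math. Phys. 15 (2003) 93, Thm. 3.8, §10 (entropy and variational principle for lattice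
  fermion systems). [cite: ArakiMoriya2003, Theorem 3.8 and §10]
* D. Ruelle, *Statistical Mechanics: Rigorous Results* (1969), §3.4 (canonical vs grand-canonical). [cite: Ruelle1969, §3.4]
-/

noncomputable section

open scoped ComplexOrder BigOperators
open Finset Literature.InformationTheory.Entropy

namespace Literature.MathematicalPhysics.QuantumLattice

open Matrix HubbardWave0 Literature.Probability.LatticeModels ThermodynamicLimit
open _root_.Filter
open scoped _root_.Topology

/-! ### §1 (real analysis) A concave function touching a chord at an interior point is the chord on the segment -/

/-- **Equality in Jensen at one interior point forces affinity on the segment (concave version).** Let `f` be concave on a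
convex set `s ∋ x, y`, `0 < a`, `0 < b`, `a + b = 1`, and `f(a x + b y) = a f x + b f y`. Then for all `p, q ≥ 0` with
`p + q = 1`: `f(p x + q y) = p f x + q f y`. [cite: Israel1979, Thm. I.2.4] -/
theorem concaveOn_affine_of_eq_convexComb {s : Set ℝ} {f : ℝ → ℝ} (hf : ConcaveOn ℝ s f) {x y : ℝ} (hx : x ∈ s) (hy : y ∈ s)
    {a b : ℝ} (ha : 0 < a) (hb : 0 < b) (hab : a + b = 1) (heq : f (a * x + b * y) = a * f x + b * f y)
    {p q : ℝ} (hp : 0 ≤ p) (hq : 0 ≤ q) (hpq : p + q = 1) :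
    f (p * x + q * y) = p * f x + q * f y := by
  have hneg : ConvexOn ℝ s (-f) := hf.neg
  have heq' : (-f) (a * x + b * y) = a * (-f) x + b * (-f) y := by
    simp only [Pi.neg_apply, heq]; ring
  have h := convexOn_affine_of_eq_convexComb hneg hx hy ha hb hab heq' hp hq hpq
  simp only [Pi.neg_apply] at h
  linarith

/-- `log(ℓ²+1) ≤ 2ℓ` for `ℓ ≥ 1`. [folklore] -/
private theorem log_sq_add_one_le' (ℓ : ℕ) (hℓ : 1 ≤ ℓ) : Real.log ((ℓ : ℝ) ^ 2 + 1) ≤ 2 * ℓ := by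
  have hℓ' : (1 : ℝ) ≤ ℓ := by exact_mod_cast hℓ
  have h1 : (ℓ : ℝ) ^ 2 + 1 ≤ ((ℓ : ℝ) + 1) ^ 2 := by nlinarith
  have h2 : Real.log ((ℓ : ℝ) ^ 2 + 1) ≤ Real.log (((ℓ : ℝ) + 1) ^ 2) := Real.log_le_log (by positivity) h1
  have h3 : Real.log (((ℓ : ℝ) + 1) ^ 2) = 2 * Real.log ((ℓ : ℝ) + 1) := by
    rw [Real.log_pow]; push_cast; ring
  have h4 : Real.log ((ℓ : ℝ) + 1) ≤ (ℓ : ℝ) + 1 - 1 := Real.log_le_sub_one_of_pos (by positivity)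
  linarith

/-- The error budget per site: `(β(8|t|+16|t'|)ℓ + 2log(ℓ²+1) + log 2)/ℓ² ≤ (β(8|t|+16|t'|) + 5)/ℓ` (`ℓ ≥ 1`, `β ≥ 0`).
[folklore] -/
private theorem err_div_sq_le' {β : ℝ} (hβ : 0 ≤ β) (t t' : ℝ) (ℓ : ℕ) (hℓ : 1 ≤ ℓ) :
    (β * ((8 * |t| + 16 * |t'|) * ℓ) + 2 * Real.log ((ℓ : ℝ) ^ 2 + 1) + Real.log 2) / (ℓ : ℝ) ^ 2 ≤
      (β * (8 * |t| + 16 * |t'|) + 5) / ℓ := by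
  have hℓ' : (1 : ℝ) ≤ ℓ := by exact_mod_cast hℓ
  have hℓpos : (0 : ℝ) < ℓ := by linarith
  have hlog := log_sq_add_one_le' ℓ hℓ
  have hlog2 : Real.log 2 ≤ (ℓ : ℝ) := by
    have : Real.log 2 < 1 := by
      have h := Real.log_two_lt_d9; norm_num at h; linarith
    linarith
  have hK : 0 ≤ β * (8 * |t| + 16 * |t'|) := by positivity
  rw [div_le_div_iff₀ (by positivity) hℓpos]
  have e1 : (β * (8 * |t| + 16 * |t'|) + 5) * (ℓ : ℝ) ^ 2 =
      (β * ((8 * |t| + 16 * |t'|) * ℓ) + 5 * ℓ) * ℓ := by ring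
  rw [e1]
  refine mul_le_mul_of_nonneg_right ?_ hℓpos.le
  linarith

namespace InfVolFermionState

/-! ### §2 The canonical variational upper bound for every translation-invariant state -/

section Upper

variable (t t' : ℝ) {U : ℝ} (hU : 0 ≤ U) {β : ℝ} (hβ : 0 < β) {ω : InfVolFermionState 2}
include hU hβ

/-- **No translation-invariant state has entropy density above `p(ρ(ω)) + βe_Φ(ω)`** (finite-box form, `0 < ρ(ω) < 2`,
`ℓ ≥ 1`): `S(ω_{[0,ℓ)²}) ≤ ℓ²·(pressureTT' β t t' U ρ(ω) + β e_Φ(ω)) + β(8|t|+16|t'|)ℓ + 2 log(ℓ²+1)` — the grand-canonical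
upper bound at a supporting chemical potential `μ₀` of the concave `p` at `ρ(ω)` (`p(ρ) = P(μ₀) − βμ₀ρ`).
[cite: Israel1979, Lemma II.3.1] [cite: Ruelle1969, §3.4] -/
theorem IsTranslationInvariant.vonNeumannEntropy_rdm_halfOpenBox_le_pressureTT' (hω : ω.IsTranslationInvariant)
    (hρ0 : 0 < ω.density) (hρ2 : ω.density < 2) {ℓ : ℕ} (hℓ : 1 ≤ ℓ) :
    vonNeumannEntropy (ω.rdm (halfOpenBox 2 ℓ)) ≤
      (ℓ : ℝ) ^ 2 * (pressureTT' β t t' U ω.density + β * ω.meanEnergy (hubbardTTPrimeFermionInteraction t t' U) 1) +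
        β * ((8 * |t| + 16 * |t'|) * ℓ) + 2 * Real.log ((ℓ : ℝ) ^ 2 + 1) := by
  obtain ⟨μ₀, hμ₀⟩ := exists_chemicalPotential_pressureTT'_eq hβ.le t t' hU hβ hρ0 hρ2
  have hup := hω.vonNeumannEntropy_rdm_halfOpenBox_le hβ.le t t' hU μ₀ 0 hℓ
  rw [gcPressureTT'Zeeman_zero, zero_mul, sub_zero] at hup
  have e : gcPressureTT' β t t' U μ₀ +
        β * (ω.meanEnergy (hubbardTTPrimeFermionInteraction t t' U) 1 - μ₀ * ω.density) =
      pressureTT' β t t' U ω.density + β * ω.meanEnergy (hubbardTTPrimeFermionInteraction t t' U) 1 := by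
    rw [hμ₀]; ring
  rw [e] at hup
  exact hup

/-- **Per-site form**: `S(ω_{[0,ℓ)²})/ℓ² ≤ p(ρ(ω)) + βe_Φ(ω) + (β(8|t|+16|t'|) + 4)/ℓ`. [cite: Israel1979, Lemma II.3.1] -/
theorem IsTranslationInvariant.vonNeumannEntropy_rdm_halfOpenBox_div_sq_le_pressureTT' (hω : ω.IsTranslationInvariant)
    (hρ0 : 0 < ω.density) (hρ2 : ω.density < 2) {ℓ : ℕ} (hℓ : 1 ≤ ℓ) :
    vonNeumannEntropy (ω.rdm (halfOpenBox 2 ℓ)) / (ℓ : ℝ) ^ 2 ≤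
      pressureTT' β t t' U ω.density + β * ω.meanEnergy (hubbardTTPrimeFermionInteraction t t' U) 1 +
        (β * (8 * |t| + 16 * |t'|) + 4) / ℓ := by
  have h := hω.vonNeumannEntropy_rdm_halfOpenBox_le_pressureTT' t t' hU hβ hρ0 hρ2 hℓ
  have hlog := log_sq_add_one_le' ℓ hℓ
  have hℓpos : (0 : ℝ) < ℓ := by exact_mod_cast hℓ
  have hℓ2 : (0 : ℝ) < (ℓ : ℝ) ^ 2 := by positivity
  rw [div_le_iff₀ hℓ2]
  have e : (pressureTT' β t t' U ω.density + β * ω.meanEnergy (hubbardTTPrimeFermionInteraction t t' U) 1 +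
        (β * (8 * |t| + 16 * |t'|) + 4) / ℓ) * (ℓ : ℝ) ^ 2 =
      (ℓ : ℝ) ^ 2 * (pressureTT' β t t' U ω.density + β * ω.meanEnergy (hubbardTTPrimeFermionInteraction t t' U) 1) +
        β * ((8 * |t| + 16 * |t'|) * ℓ) + 4 * ℓ := by
    field_simp
    ring
  rw [e]
  nlinarith [hβ.le]

end Upper

/-! ### §3 Mixtures of translation-invariant states that are canonical thermal states -/

section Mixture

variable (t t' : ℝ) {U : ℝ} (hU : 0 ≤ U) {β : ℝ} (hβ : 0 < β) {ω₁ ω₂ : InfVolFermionState 2} {Ls : ℕ → ℕ} {n : ℝ}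
include hU hβ

omit hU hβ in
/-- **The mean density of a coexisting canonical thermal state is the mixture of the phase densities**:
`n = λρ(ω₁) + (1−λ)ρ(ω₂)`. [cite: Ruelle1969, §3.4] -/
theorem IsTorusLimitOfMixture.density_eq_convexComb_of_mix_sectorGibbs (hn0 : 0 ≤ n) (hn2 : n ≤ 2)
    {lam : ℝ} (hl0 : 0 ≤ lam) (hl1 : lam ≤ 1)
    (hω : (mix lam hl0 hl1 ω₁ ω₂).IsTorusLimitOfMixture (sectorGibbsCount n) (fun L => sectorGibbsWeightTT' β t t' U n L)
      (fun L => sectorGibbsVectorTT' t t' U n L) Ls)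
    (hLs : Tendsto Ls atTop atTop) :
    n = lam * ω₁.density + (1 - lam) * ω₂.density := by
  rw [← density_mix lam hl0 hl1 ω₁ ω₂]
  exact (hω.density_eq_of_sectorGibbs t t' U hn0 hn2 β hLs).symm

omit hU hβ in
/-- The energy of the mixture is the mixture of the energies (`e_Φ` is affine). [folklore] -/
private theorem meanEnergy_mix_tt' {lam : ℝ} (hl0 : 0 ≤ lam) (hl1 : lam ≤ 1) (t t' U : ℝ) :
    (mix lam hl0 hl1 ω₁ ω₂).meanEnergy (hubbardTTPrimeFermionInteraction t t' U) 1 =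
      lam * ω₁.meanEnergy (hubbardTTPrimeFermionInteraction t t' U) 1 +
        (1 - lam) * ω₂.meanEnergy (hubbardTTPrimeFermionInteraction t t' U) 1 :=
  meanEnergy_mix _ _ lam hl0 hl1 ω₁ ω₂

/-- **Coexistence forces the chord inequality, finite-box form.** If `ω₁, ω₂` are translation invariant with densities
in `(0,2)`, `0 < λ ≤ 1`, and the mixture `λω₁ + (1−λ)ω₂` is a canonical thermal torus-limit state at `(β; t,t',U; n)`,
`0 < n < 2`, then for every `ℓ ≥ 1`:
`ℓ²·p(n) ≤ ℓ²·(λ p(ρ₁) + (1−λ) p(ρ₂)) + β(8|t|+16|t'|)ℓ + 2log(ℓ²+1) + log 2`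
(entropy of the mixture `≥ ℓ²(p(n) + βe)`, mixing bound `+ log 2`, §2 for each phase, affinity of `e_Φ`).
[cite: Israel1979, Thm. I.2.4] [cite: ArakiMoriya2003, Theorem 3.8 and §10] -/
theorem IsTorusLimitOfMixture.sq_mul_pressureTT'_le_of_mix_sectorGibbs (h₁ : ω₁.IsTranslationInvariant)
    (h₂ : ω₂.IsTranslationInvariant) (hρ₁0 : 0 < ω₁.density) (hρ₁2 : ω₁.density < 2) (hρ₂0 : 0 < ω₂.density)
    (hρ₂2 : ω₂.density < 2) (hn0 : 0 < n) (hn2 : n < 2) {lam : ℝ} (hl0 : 0 < lam) (hl1 : lam ≤ 1)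
    (hω : (mix lam hl0.le hl1 ω₁ ω₂).IsTorusLimitOfMixture (sectorGibbsCount n) (fun L => sectorGibbsWeightTT' β t t' U n L)
      (fun L => sectorGibbsVectorTT' t t' U n L) Ls)
    (hLs : Tendsto Ls atTop atTop) {ℓ : ℕ} (hℓ : 1 ≤ ℓ) :
    (ℓ : ℝ) ^ 2 * pressureTT' β t t' U n ≤
      (ℓ : ℝ) ^ 2 * (lam * pressureTT' β t t' U ω₁.density + (1 - lam) * pressureTT' β t t' U ω₂.density) +
        (β * ((8 * |t| + 16 * |t'|) * ℓ) + 2 * Real.log ((ℓ : ℝ) ^ 2 + 1)) + Real.log 2 := by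
  set ω := mix lam hl0.le hl1 ω₁ ω₂ with hωdef
  have hlow := hω.sq_mul_le_vonNeumannEntropy_rdm_halfOpenBox_of_sectorGibbs t t' hU hβ hn0.le hn2 hLs hℓ
  have hup₁ := h₁.vonNeumannEntropy_rdm_halfOpenBox_le_pressureTT' t t' hU hβ hρ₁0 hρ₁2 hℓ
  have hup₂ := h₂.vonNeumannEntropy_rdm_halfOpenBox_le_pressureTT' t t' hU hβ hρ₂0 hρ₂2 hℓ
  have hmixS := vonNeumannEntropy_rdm_mix_le lam hl0.le hl1 ω₁ ω₂ (halfOpenBox 2 ℓ)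
  rw [← hωdef] at hmixS
  have he : ω.meanEnergy (hubbardTTPrimeFermionInteraction t t' U) 1 =
      lam * ω₁.meanEnergy (hubbardTTPrimeFermionInteraction t t' U) 1 +
        (1 - lam) * ω₂.meanEnergy (hubbardTTPrimeFermionInteraction t t' U) 1 := meanEnergy_mix_tt' hl0.le hl1 t t' U
  rw [he] at hlow
  have hl1' : 0 ≤ 1 - lam := by linarith
  have hℓ2 : 0 ≤ (ℓ : ℝ) ^ 2 := by positivity
  nlinarith [hlow, hmixS, mul_le_mul_of_nonneg_left hup₁ hl0.le, mul_le_mul_of_nonneg_left hup₂ hl1', hβ.le]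

/-- **COEXISTENCE FORCES THE CHORD INEQUALITY**: under the hypotheses of `…sq_mul_pressureTT'_le_of_mix_sectorGibbs`,
`p(n) ≤ λ p(ρ(ω₁)) + (1−λ) p(ρ(ω₂))` (divide by `ℓ²`, `ℓ → ∞`). [cite: Israel1979, Thm. I.2.4] -/
theorem IsTorusLimitOfMixture.pressureTT'_le_convexComb_of_mix_sectorGibbs (h₁ : ω₁.IsTranslationInvariant)
    (h₂ : ω₂.IsTranslationInvariant) (hρ₁0 : 0 < ω₁.density) (hρ₁2 : ω₁.density < 2) (hρ₂0 : 0 < ω₂.density)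
    (hρ₂2 : ω₂.density < 2) (hn0 : 0 < n) (hn2 : n < 2) {lam : ℝ} (hl0 : 0 < lam) (hl1 : lam ≤ 1)
    (hω : (mix lam hl0.le hl1 ω₁ ω₂).IsTorusLimitOfMixture (sectorGibbsCount n) (fun L => sectorGibbsWeightTT' β t t' U n L)
      (fun L => sectorGibbsVectorTT' t t' U n L) Ls)
    (hLs : Tendsto Ls atTop atTop) :
    pressureTT' β t t' U n ≤ lam * pressureTT' β t t' U ω₁.density + (1 - lam) * pressureTT' β t t' U ω₂.density := by
  set C : ℝ := β * (8 * |t| + 16 * |t'|) + 5 with hC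
  have hCpos : 0 < C := by have : 0 ≤ β * (8 * |t| + 16 * |t'|) := by positivity
                           linarith
  refine le_of_forall_pos_le_add fun ε hε => ?_
  -- choose `ℓ ≥ C/ε`, `ℓ ≥ 1`
  obtain ⟨N, hN⟩ := exists_nat_gt (C / ε)
  set ℓ : ℕ := max N 1 with hℓdef
  have hℓ1 : 1 ≤ ℓ := le_max_right _ _
  have hℓN : (N : ℝ) ≤ ℓ := by exact_mod_cast le_max_left N 1
  have hℓpos : (0 : ℝ) < ℓ := by exact_mod_cast hℓ1
  have hℓ2 : (0 : ℝ) < (ℓ : ℝ) ^ 2 := by positivity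
  have h := hω.sq_mul_pressureTT'_le_of_mix_sectorGibbs t t' hU hβ h₁ h₂ hρ₁0 hρ₁2 hρ₂0 hρ₂2 hn0 hn2 hl0 hl1 hLs hℓ1
  have herr := err_div_sq_le' hβ.le t t' ℓ hℓ1
  -- `C/ℓ ≤ ε`
  have hCℓ : C / ℓ ≤ ε := by
    rw [div_le_iff₀ hℓpos]
    have : C / ε < ℓ := lt_of_lt_of_le hN hℓN
    rw [div_lt_iff₀ hε] at this
    linarith
  -- divide the finite-box inequality by `ℓ²`
  have hdiv : pressureTT' β t t' U n ≤
      lam * pressureTT' β t t' U ω₁.density + (1 - lam) * pressureTT' β t t' U ω₂.density +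
        (β * ((8 * |t| + 16 * |t'|) * ℓ) + 2 * Real.log ((ℓ : ℝ) ^ 2 + 1) + Real.log 2) / (ℓ : ℝ) ^ 2 := by
    rw [add_div' _ _ _ hℓ2.ne', le_div_iff₀ hℓ2]
    linarith
  linarith [hdiv, herr.trans hCℓ]

/-- **COEXISTENCE FORCES THE CHORD IDENTITY** (with concavity of `p` in the density):
`p(λρ₁ + (1−λ)ρ₂) = λ p(ρ₁) + (1−λ) p(ρ₂)`. [cite: Israel1979, Thm. I.2.4] [cite: EmeryKivelsonLin1990, pp. 475–476] -/
theorem IsTorusLimitOfMixture.pressureTT'_eq_convexComb_of_mix_sectorGibbs (h₁ : ω₁.IsTranslationInvariant)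
    (h₂ : ω₂.IsTranslationInvariant) (hρ₁0 : 0 < ω₁.density) (hρ₁2 : ω₁.density < 2) (hρ₂0 : 0 < ω₂.density)
    (hρ₂2 : ω₂.density < 2) (hn0 : 0 < n) (hn2 : n < 2) {lam : ℝ} (hl0 : 0 < lam) (hl1 : lam ≤ 1)
    (hω : (mix lam hl0.le hl1 ω₁ ω₂).IsTorusLimitOfMixture (sectorGibbsCount n) (fun L => sectorGibbsWeightTT' β t t' U n L)
      (fun L => sectorGibbsVectorTT' t t' U n L) Ls)
    (hLs : Tendsto Ls atTop atTop) :
    pressureTT' β t t' U (lam * ω₁.density + (1 - lam) * ω₂.density) =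
      lam * pressureTT' β t t' U ω₁.density + (1 - lam) * pressureTT' β t t' U ω₂.density := by
  have hn := hω.density_eq_convexComb_of_mix_sectorGibbs t t' hn0.le hn2.le hl0.le hl1 hLs
  have hle := hω.pressureTT'_le_convexComb_of_mix_sectorGibbs t t' hU hβ h₁ h₂ hρ₁0 hρ₁2 hρ₂0 hρ₂2 hn0 hn2 hl0 hl1 hLs
  rw [hn] at hle
  refine le_antisymm hle ?_
  have hc := (concaveOn_pressureTT'_density hβ.le t t' hU).2 ⟨hρ₁0.le, hρ₁2⟩ ⟨hρ₂0.le, hρ₂2⟩ hl0.le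
    (by linarith : 0 ≤ 1 - lam) (by ring : lam + (1 - lam) = 1)
  simpa [smul_eq_mul] using hc

/-- **THERMAL PHASE SEPARATION FORCES A FLAT PIECE OF THE PRESSURE–DENSITY CURVE.** If a canonical thermal state at
`(β; t,t',U; n)` is the mixture `λω₁ + (1−λ)ω₂`, `0 < λ < 1`, of translation-invariant states of densities `ρ₁, ρ₂ ∈ (0,2)`, then
`p(β; ·)` is AFFINE on `[ρ₁, ρ₂]`: `p(aρ₁ + bρ₂) = a p(ρ₁) + b p(ρ₂)` for all `a, b ≥ 0`, `a + b = 1`.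
[cite: Israel1979, Thm. I.2.4] [cite: EmeryKivelsonLin1990, pp. 475–476] -/
theorem IsTorusLimitOfMixture.pressureTT'_eq_chord_on_segment_of_mix_sectorGibbs (h₁ : ω₁.IsTranslationInvariant)
    (h₂ : ω₂.IsTranslationInvariant) (hρ₁0 : 0 < ω₁.density) (hρ₁2 : ω₁.density < 2) (hρ₂0 : 0 < ω₂.density)
    (hρ₂2 : ω₂.density < 2) (hn0 : 0 < n) (hn2 : n < 2) {lam : ℝ} (hl0 : 0 < lam) (hl1 : lam < 1)
    (hω : (mix lam hl0.le hl1.le ω₁ ω₂).IsTorusLimitOfMixture (sectorGibbsCount n)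
      (fun L => sectorGibbsWeightTT' β t t' U n L) (fun L => sectorGibbsVectorTT' t t' U n L) Ls)
    (hLs : Tendsto Ls atTop atTop) {a b : ℝ} (ha : 0 ≤ a) (hb : 0 ≤ b) (hab : a + b = 1) :
    pressureTT' β t t' U (a * ω₁.density + b * ω₂.density) =
      a * pressureTT' β t t' U ω₁.density + b * pressureTT' β t t' U ω₂.density := by
  have heq := hω.pressureTT'_eq_convexComb_of_mix_sectorGibbs t t' hU hβ h₁ h₂ hρ₁0 hρ₁2 hρ₂0 hρ₂2 hn0 hn2 hl0 hl1.le hLs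
  exact concaveOn_affine_of_eq_convexComb (concaveOn_pressureTT'_density hβ.le t t' hU) ⟨hρ₁0.le, hρ₁2⟩ ⟨hρ₂0.le, hρ₂2⟩
    hl0 (by linarith) (by ring) heq ha hb hab

/-! ### §4 Each phase is a variational equilibrium state at its own density -/

/-- **The first phase carries the entropy density `p(ρ₁) + βe_Φ(ω₁)`, finite-box two-sided window**: for every `ℓ ≥ 1`,
`p(ρ₁) + βe₁ − [(1−λ)(β(8|t|+16|t'|)+4)/ℓ + log 2/ℓ²]/λ ≤ S(ω₁,[0,ℓ)²)/ℓ² ≤ p(ρ₁) + βe₁ + (β(8|t|+16|t'|)+4)/ℓ`.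
[cite: ArakiMoriya2003, Theorem 3.8 and §10] [cite: Israel1979, Thm. I.2.4] -/
theorem IsTorusLimitOfMixture.vonNeumannEntropy_rdm_div_sq_mem_Icc_of_mix_sectorGibbs_left
    (h₁ : ω₁.IsTranslationInvariant) (h₂ : ω₂.IsTranslationInvariant) (hρ₁0 : 0 < ω₁.density) (hρ₁2 : ω₁.density < 2)
    (hρ₂0 : 0 < ω₂.density) (hρ₂2 : ω₂.density < 2) (hn0 : 0 < n) (hn2 : n < 2) {lam : ℝ} (hl0 : 0 < lam) (hl1 : lam ≤ 1)
    (hω : (mix lam hl0.le hl1 ω₁ ω₂).IsTorusLimitOfMixture (sectorGibbsCount n) (fun L => sectorGibbsWeightTT' β t t' U n L)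
      (fun L => sectorGibbsVectorTT' t t' U n L) Ls)
    (hLs : Tendsto Ls atTop atTop) {ℓ : ℕ} (hℓ : 1 ≤ ℓ) :
    vonNeumannEntropy (ω₁.rdm (halfOpenBox 2 ℓ)) / (ℓ : ℝ) ^ 2 ∈ Set.Icc
      (pressureTT' β t t' U ω₁.density + β * ω₁.meanEnergy (hubbardTTPrimeFermionInteraction t t' U) 1 -
        ((1 - lam) * (β * (8 * |t| + 16 * |t'|) + 4) / ℓ + Real.log 2 / (ℓ : ℝ) ^ 2) / lam)
      (pressureTT' β t t' U ω₁.density + β * ω₁.meanEnergy (hubbardTTPrimeFermionInteraction t t' U) 1 +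
        (β * (8 * |t| + 16 * |t'|) + 4) / ℓ) := by
  refine ⟨?_, h₁.vonNeumannEntropy_rdm_halfOpenBox_div_sq_le_pressureTT' t t' hU hβ hρ₁0 hρ₁2 hℓ⟩
  set ω := mix lam hl0.le hl1 ω₁ ω₂ with hωdef
  have hlow := hω.sq_mul_le_vonNeumannEntropy_rdm_halfOpenBox_of_sectorGibbs t t' hU hβ hn0.le hn2 hLs hℓ
  have hup₂ := h₂.vonNeumannEntropy_rdm_halfOpenBox_div_sq_le_pressureTT' t t' hU hβ hρ₂0 hρ₂2 hℓ
  have hmixS := vonNeumannEntropy_rdm_mix_le lam hl0.le hl1 ω₁ ω₂ (halfOpenBox 2 ℓ)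
  rw [← hωdef] at hmixS
  have he : ω.meanEnergy (hubbardTTPrimeFermionInteraction t t' U) 1 =
      lam * ω₁.meanEnergy (hubbardTTPrimeFermionInteraction t t' U) 1 +
        (1 - lam) * ω₂.meanEnergy (hubbardTTPrimeFermionInteraction t t' U) 1 := meanEnergy_mix_tt' hl0.le hl1 t t' U
  rw [he] at hlow
  -- concavity: `p(n) ≥ λp(ρ₁) + (1−λ)p(ρ₂)` at `n = λρ₁ + (1−λ)ρ₂`
  have hn := hω.density_eq_convexComb_of_mix_sectorGibbs t t' hn0.le hn2.le hl0.le hl1 hLs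
  have hconc : lam * pressureTT' β t t' U ω₁.density + (1 - lam) * pressureTT' β t t' U ω₂.density ≤
      pressureTT' β t t' U n := by
    have hc := (concaveOn_pressureTT'_density hβ.le t t' hU).2 ⟨hρ₁0.le, hρ₁2⟩ ⟨hρ₂0.le, hρ₂2⟩ hl0.le
      (by linarith : 0 ≤ 1 - lam) (by ring : lam + (1 - lam) = 1)
    rw [hn]
    simpa [smul_eq_mul] using hc
  have hℓpos : (0 : ℝ) < ℓ := by exact_mod_cast hℓ
  have hℓ2 : (0 : ℝ) < (ℓ : ℝ) ^ 2 := by positivity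
  have hl1' : 0 ≤ 1 - lam := by linarith
  -- per-site bounds for `S₂` and the mixture, multiplied back by `ℓ²`
  set S₁ := vonNeumannEntropy (ω₁.rdm (halfOpenBox 2 ℓ)) with hS₁
  set S₂ := vonNeumannEntropy (ω₂.rdm (halfOpenBox 2 ℓ)) with hS₂
  set p₁ := pressureTT' β t t' U ω₁.density with hp₁
  set p₂ := pressureTT' β t t' U ω₂.density with hp₂
  set e₁ := ω₁.meanEnergy (hubbardTTPrimeFermionInteraction t t' U) 1 with he₁
  set e₂ := ω₂.meanEnergy (hubbardTTPrimeFermionInteraction t t' U) 1 with he₂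
  set E : ℝ := (β * (8 * |t| + 16 * |t'|) + 4) / ℓ with hE
  have hup₂' : S₂ ≤ (ℓ : ℝ) ^ 2 * (p₂ + β * e₂ + E) := by
    have := (div_le_iff₀ hℓ2).1 hup₂
    linarith
  -- `λ S₁ ≥ ℓ²(p(n) + β(λe₁+(1−λ)e₂)) − (1−λ)ℓ²(p₂ + βe₂ + E) − log 2 ≥ λℓ²(p₁ + βe₁) − (1−λ)ℓ²E − log 2`
  have key : lam * ((ℓ : ℝ) ^ 2 * (p₁ + β * e₁)) - ((1 - lam) * ((ℓ : ℝ) ^ 2 * E) + Real.log 2) ≤ lam * S₁ := by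
    nlinarith [hlow, hmixS, mul_le_mul_of_nonneg_left hup₂' hl1', mul_le_mul_of_nonneg_left hconc hℓ2.le, hβ.le]
  rw [le_div_iff₀ hℓ2]
  -- divide `key` by `λ`
  have key' : (ℓ : ℝ) ^ 2 * (p₁ + β * e₁) - ((1 - lam) * ((ℓ : ℝ) ^ 2 * E) + Real.log 2) / lam ≤ S₁ := by
    have h1 : (lam * ((ℓ : ℝ) ^ 2 * (p₁ + β * e₁)) - ((1 - lam) * ((ℓ : ℝ) ^ 2 * E) + Real.log 2)) / lam ≤ S₁ := by
      rw [div_le_iff₀ hl0]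
      linarith [key]
    have h2 : (lam * ((ℓ : ℝ) ^ 2 * (p₁ + β * e₁)) - ((1 - lam) * ((ℓ : ℝ) ^ 2 * E) + Real.log 2)) / lam =
        (ℓ : ℝ) ^ 2 * (p₁ + β * e₁) - ((1 - lam) * ((ℓ : ℝ) ^ 2 * E) + Real.log 2) / lam := by
      field_simp
    linarith [h1, h2]
  have e : (p₁ + β * e₁ - ((1 - lam) * (β * (8 * |t| + 16 * |t'|) + 4) / ℓ + Real.log 2 / (ℓ : ℝ) ^ 2) / lam) *
        (ℓ : ℝ) ^ 2 =
      (ℓ : ℝ) ^ 2 * (p₁ + β * e₁) - ((1 - lam) * ((ℓ : ℝ) ^ 2 * E) + Real.log 2) / lam := by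
    rw [hE]
    field_simp
  rw [e]
  exact key'

/-- **EACH PHASE IS A VARIATIONAL EQUILIBRIUM STATE AT ITS OWN DENSITY**: the entropy density of the first phase exists and
equals `p(β; t,t',U; ρ(ω₁)) + β e_Φ(ω₁)` — `S(ω₁,[0,ℓ)²})/ℓ² → p(ρ₁) + βe₁` (by symmetry the same for `ω₂`).
[cite: ArakiMoriya2003, Theorem 3.8 and §10] [cite: Israel1979, Thm. I.2.4] -/
theorem IsTorusLimitOfMixture.tendsto_vonNeumannEntropy_rdm_div_sq_of_mix_sectorGibbs_left
    (h₁ : ω₁.IsTranslationInvariant) (h₂ : ω₂.IsTranslationInvariant) (hρ₁0 : 0 < ω₁.density) (hρ₁2 : ω₁.density < 2)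
    (hρ₂0 : 0 < ω₂.density) (hρ₂2 : ω₂.density < 2) (hn0 : 0 < n) (hn2 : n < 2) {lam : ℝ} (hl0 : 0 < lam) (hl1 : lam ≤ 1)
    (hω : (mix lam hl0.le hl1 ω₁ ω₂).IsTorusLimitOfMixture (sectorGibbsCount n) (fun L => sectorGibbsWeightTT' β t t' U n L)
      (fun L => sectorGibbsVectorTT' t t' U n L) Ls)
    (hLs : Tendsto Ls atTop atTop) :
    Tendsto (fun ℓ : ℕ => vonNeumannEntropy (ω₁.rdm (halfOpenBox 2 ℓ)) / (ℓ : ℝ) ^ 2) atTop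
      (𝓝 (pressureTT' β t t' U ω₁.density + β * ω₁.meanEnergy (hubbardTTPrimeFermionInteraction t t' U) 1)) := by
  set c : ℝ := pressureTT' β t t' U ω₁.density + β * ω₁.meanEnergy (hubbardTTPrimeFermionInteraction t t' U) 1 with hc
  set K : ℝ := β * (8 * |t| + 16 * |t'|) + 4 with hK
  -- lower and upper envelopes both tend to `c`
  have hinv : Tendsto (fun ℓ : ℕ => (ℓ : ℝ)⁻¹) atTop (𝓝 0) := tendsto_inv_atTop_nhds_zero_nat (𝕜 := ℝ)
  have hinv2 : Tendsto (fun ℓ : ℕ => ((ℓ : ℝ) ^ 2)⁻¹) atTop (𝓝 0) := by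
    have h := hinv.mul hinv
    rw [mul_zero] at h
    refine h.congr fun ℓ => ?_
    rw [← mul_inv, sq]
  have hupper : Tendsto (fun ℓ : ℕ => c + K / ℓ) atTop (𝓝 c) := by
    have h := (hinv.const_mul K).const_add c
    rw [mul_zero, add_zero] at h
    refine h.congr fun ℓ => ?_
    rw [div_eq_mul_inv]
  have hlower : Tendsto (fun ℓ : ℕ => c - ((1 - lam) * K / ℓ + Real.log 2 / (ℓ : ℝ) ^ 2) / lam) atTop (𝓝 c) := by
    have h1 : Tendsto (fun ℓ : ℕ => (1 - lam) * K / ℓ) atTop (𝓝 0) := by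
      have h := hinv.const_mul ((1 - lam) * K)
      rw [mul_zero] at h
      refine h.congr fun ℓ => ?_
      rw [div_eq_mul_inv]
    have h2 : Tendsto (fun ℓ : ℕ => Real.log 2 / (ℓ : ℝ) ^ 2) atTop (𝓝 0) := by
      have h := hinv2.const_mul (Real.log 2)
      rw [mul_zero] at h
      refine h.congr fun ℓ => ?_
      rw [div_eq_mul_inv]
    have h3 := ((h1.add h2).div_const lam).const_sub c
    rw [add_zero, zero_div, sub_zero] at h3
    exact h3
  refine tendsto_of_tendsto_of_tendsto_of_le_of_le' hlower hupper ?_ ?_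
  · filter_upwards [eventually_ge_atTop 1] with ℓ hℓ
    exact (hω.vonNeumannEntropy_rdm_div_sq_mem_Icc_of_mix_sectorGibbs_left t t' hU hβ h₁ h₂ hρ₁0 hρ₁2 hρ₂0 hρ₂2 hn0 hn2
      hl0 hl1 hLs hℓ).1
  · filter_upwards [eventually_ge_atTop 1] with ℓ hℓ
    exact (hω.vonNeumannEntropy_rdm_div_sq_mem_Icc_of_mix_sectorGibbs_left t t' hU hβ h₁ h₂ hρ₁0 hρ₁2 hρ₂0 hρ₂2 hn0 hn2
      hl0 hl1 hLs hℓ).2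

/-! ### §5 Certified exclusion of thermal phase separation -/

/-- **CERTIFIED EXCLUSION OF THERMAL PHASE SEPARATION.** Let `ω₁, ω₂` be translation-invariant states with densities
`ρ₁, ρ₂ ∈ (0,2)` and `0 < λ ≤ 1`; let `W ≤ p(β; n)` be a certified pressure FLOOR at `n = λρ₁ + (1−λ)ρ₂` and
`p(β; ρ₁) ≤ Q₁`, `p(β; ρ₂) ≤ Q₂` certified pressure CAPS with `λQ₁ + (1−λ)Q₂ < W`. Then the mixture `λω₁ + (1−λ)ω₂` is NOT
a canonical thermal torus-limit state at `(β; t,t',U; n)` along any `Ls → ∞`: no thermal phase separation into the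
densities `ρ₁, ρ₂`. [cite: Israel1979, Thm. I.2.4] [cite: EmeryKivelsonLin1990, pp. 475–476] -/
theorem not_isTorusLimitOfMixture_mix_of_chord_lt_floor (h₁ : ω₁.IsTranslationInvariant)
    (h₂ : ω₂.IsTranslationInvariant) (hρ₁0 : 0 < ω₁.density) (hρ₁2 : ω₁.density < 2) (hρ₂0 : 0 < ω₂.density)
    (hρ₂2 : ω₂.density < 2) (hn0 : 0 < n) (hn2 : n < 2) {lam : ℝ} (hl0 : 0 < lam) (hl1 : lam ≤ 1)
    (hLs : Tendsto Ls atTop atTop) {W Q₁ Q₂ : ℝ} (hW : W ≤ pressureTT' β t t' U n)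
    (hQ₁ : pressureTT' β t t' U ω₁.density ≤ Q₁) (hQ₂ : pressureTT' β t t' U ω₂.density ≤ Q₂)
    (hgap : lam * Q₁ + (1 - lam) * Q₂ < W) :
    ¬ (mix lam hl0.le hl1 ω₁ ω₂).IsTorusLimitOfMixture (sectorGibbsCount n) (fun L => sectorGibbsWeightTT' β t t' U n L)
      (fun L => sectorGibbsVectorTT' t t' U n L) Ls := by
  intro hω
  have hle := hω.pressureTT'_le_convexComb_of_mix_sectorGibbs t t' hU hβ h₁ h₂ hρ₁0 hρ₁2 hρ₂0 hρ₂2 hn0 hn2 hl0 hl1 hLs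
  have hl1' : 0 ≤ 1 - lam := by linarith
  nlinarith [mul_le_mul_of_nonneg_left hQ₁ hl0.le, mul_le_mul_of_nonneg_left hQ₂ hl1']

/-- **Exclusion from strict concavity at the point** (no certificates named): if `λ p(ρ₁) + (1−λ) p(ρ₂) < p(n)` then the
mixture is not a canonical thermal state at `(β; n)`. [cite: Israel1979, Thm. I.2.4] -/
theorem not_isTorusLimitOfMixture_mix_of_lt_at (h₁ : ω₁.IsTranslationInvariant)
    (h₂ : ω₂.IsTranslationInvariant) (hρ₁0 : 0 < ω₁.density) (hρ₁2 : ω₁.density < 2) (hρ₂0 : 0 < ω₂.density)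
    (hρ₂2 : ω₂.density < 2) (hn0 : 0 < n) (hn2 : n < 2) {lam : ℝ} (hl0 : 0 < lam) (hl1 : lam ≤ 1)
    (hLs : Tendsto Ls atTop atTop)
    (hlt : lam * pressureTT' β t t' U ω₁.density + (1 - lam) * pressureTT' β t t' U ω₂.density < pressureTT' β t t' U n) :
    ¬ (mix lam hl0.le hl1 ω₁ ω₂).IsTorusLimitOfMixture (sectorGibbsCount n) (fun L => sectorGibbsWeightTT' β t t' U n L)
      (fun L => sectorGibbsVectorTT' t t' U n L) Ls :=
  not_isTorusLimitOfMixture_mix_of_chord_lt_floor t t' hU hβ h₁ h₂ hρ₁0 hρ₁2 hρ₂0 hρ₂2 hn0 hn2 hl0 hl1 hLs le_rfl le_rfl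
    le_rfl hlt

/-- **Contrapositive reading for certificate tables**: if the mixture IS a canonical thermal state at `(β; n)`, then every
floor/cap triple obeys `W ≤ λQ₁ + (1−λ)Q₂` — a certified violation is a certified «no phase separation into `(ρ₁, ρ₂)`».
[cite: Israel1979, Thm. I.2.4] -/
theorem IsTorusLimitOfMixture.floor_le_convexComb_caps_of_mix_sectorGibbs (h₁ : ω₁.IsTranslationInvariant)
    (h₂ : ω₂.IsTranslationInvariant) (hρ₁0 : 0 < ω₁.density) (hρ₁2 : ω₁.density < 2) (hρ₂0 : 0 < ω₂.density)
    (hρ₂2 : ω₂.density < 2) (hn0 : 0 < n) (hn2 : n < 2) {lam : ℝ} (hl0 : 0 < lam) (hl1 : lam ≤ 1)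
    (hω : (mix lam hl0.le hl1 ω₁ ω₂).IsTorusLimitOfMixture (sectorGibbsCount n) (fun L => sectorGibbsWeightTT' β t t' U n L)
      (fun L => sectorGibbsVectorTT' t t' U n L) Ls)
    (hLs : Tendsto Ls atTop atTop) {W Q₁ Q₂ : ℝ} (hW : W ≤ pressureTT' β t t' U n)
    (hQ₁ : pressureTT' β t t' U ω₁.density ≤ Q₁) (hQ₂ : pressureTT' β t t' U ω₂.density ≤ Q₂) :
    W ≤ lam * Q₁ + (1 - lam) * Q₂ := by
  by_contra hlt
  exact not_isTorusLimitOfMixture_mix_of_chord_lt_floor t t' hU hβ h₁ h₂ hρ₁0 hρ₁2 hρ₂0 hρ₂2 hn0 hn2 hl0 hl1 hLs hW hQ₁ hQ₂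
    (lt_of_not_ge hlt) hω

end Mixture

end InfVolFermionState

end Literature.MathematicalPhysics.QuantumLattice

end
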